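import Literature.Computability.AlgebraicComplexity.STPPCharDegreeBound

/-!
# ω-census, family (b′): the certificate → theorem lane for STPP configurations in NON-abelian groups

HONEST FRAMING (pub-omega census; verbatim): lottery ticket; floor = certified bounds/negative ranges.
Census bookkeeping, not progress on `ω` (the tree proves `ω < 2.373`; no non-abelian STPP configuration in the
census comes near it).

Companion of `STPPCertificate.lean` (abelian hosts, `IsSTPP`, `Σᵢ Vᵢ^{ω/3} ≤ |H|`).  For an ARBITRARY finite group
`H` the tree now proves CKSU 2005 Thm. 5.5 (`CohnKleinbergSzegedyUmans2005_thm55_general`: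
`Σᵢ (|Aᵢ||Bᵢ||Cᵢ|)^{ω/3} ≤ Σ_k d_k^ω`) and its applied forms `Σᵢ Vᵢ^{ω/3} ≤ d_max^{ω−2}|H|`
(`…_maxCharDegree`, CKSU Cor. 1.9's estimate) and `≤ [H:N]^{ω−2}|H|` for an abelian subgroup `N`
(`…_abelianSubgroup`).  Because `ω` enters BOTH sides of `Σᵢ Vᵢ^{ω/3} ≤ d^{ω−2}|H|`, the certificate needs the
per-triple largeness `Vᵢ ≥ d³` (then `Vᵢ^{s/3}/d^{s}` is non-decreasing in `s`, so a violation at the rational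
exponent `a/b` persists at every `ω > a/b`); triples with `Vᵢ < d³` should simply be dropped from the certified
sub-family (sub-families of STPP families are STPP, `SimultaneousTPP.comp`).

* `omega_le_div_of_simultaneousTPP_maxCharDegree` — naturals `a ≥ 2b > 0`, `D > 0`, `d ≥ d_max(H)`, `d ≥ 1`,
  witnesses `qᵢ` with `qᵢ^{3b} ≤ D^{3b} Vᵢ^a` (i.e. `qᵢ/D ≤ Vᵢ^{a/(3b)}`), `Vᵢ ≥ d³`, and
  `D^b d^{a−2b} |H|^b < (Σᵢ qᵢ)^b` give `ω ≤ a/b`;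
* `omega_le_div_of_simultaneousTPP_abelianSubgroup` — the same with `d = [H:N]` for an abelian subgroup `N`
  (index-2 hosts: dihedral, dicyclic, generalized dihedral).
All hypotheses except `SimultaneousTPP` (CKSU Def. 5.1 verbatim, tree `Literature.Combinatorics.Additive`,
decidable on explicit finsets) are integer inequalities (`decide` / `norm_num`).

References: H. Cohn, R. Kleinberg, B. Szegedy, C. Umans, FOCS 2005 (arXiv:math/0511460), Def. 5.1, Thm. 5.5,
Cor. 1.9.
-/

noncomputable section

open Literature.Computability.AlgebraicComplexity Literature.Combinatorics.Additive
  Literature.RepresentationTheory.FiniteGroups Finset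

namespace Summit.MatrixMultiplication.OmegaCensus

/-- **Certificate → theorem, non-abelian host, `d_max` form.** Let `(A i, B i, C i)_{i<N}` be an STPP
configuration (CKSU Def. 5.1) in a finite group `H` all of whose character degrees are `≤ d` (`1 ≤ d`), with
volumes `Vᵢ = |A i||B i||C i| ≥ d³`.  If naturals `a ≥ 2b`, `b, D > 0` and witnesses `q i` satisfy
`(q i)^{3b} ≤ D^{3b} Vᵢ^a` and `D^b · d^{a−2b} · |H|^b < (Σᵢ q i)^b`, then `ω ≤ a/b`.
(Were `ω > a/b =: w`: `qᵢ/D ≤ Vᵢ^{w/3} ≤ d^{w−ω} Vᵢ^{ω/3}` as `Vᵢ ≥ d³`, so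
`Σ qᵢ ≤ D d^{w−ω} Σ Vᵢ^{ω/3} ≤ D d^{w−ω} d^{ω−2}|H| = D d^{w−2}|H|` by CKSU Thm. 5.5 / Cor. 1.9, contradiction
after raising to the power `b`.) [cite: CohnKleinbergSzegedyUmans2005, Thm. 5.5, Cor. 1.9 and Def. 5.1] -/
theorem omega_le_div_of_simultaneousTPP_maxCharDegree {H : Type} [Group H] [Fintype H] [DecidableEq H]
    {N : ℕ} {A B C : Fin N → Finset H} (hS : SimultaneousTPP A B C) {d : ℕ} (hd1 : 1 ≤ d)
    (hdmax : maxCharDegree H ≤ d) {a b D : ℕ} (hab : 2 * b ≤ a) (hb : 0 < b) (hD : 0 < D) (q : Fin N → ℕ)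
    (hq : ∀ i, q i ^ (3 * b) ≤ D ^ (3 * b) * ((A i).card * (B i).card * (C i).card) ^ a)
    (hbig : ∀ i, d ^ 3 ≤ (A i).card * (B i).card * (C i).card)
    (hsum : D ^ b * d ^ (a - 2 * b) * Fintype.card H ^ b < (∑ i, q i) ^ b) :
    omega ℂ ≤ (a : ℝ) / (b : ℝ) := by
  by_contra hlt
  rw [not_le] at hlt
  set w : ℝ := (a : ℝ) / (b : ℝ) with hw
  -- Thm. 5.5 (arbitrary `H`) in the `d_max` form, then `d_max ≤ d`
  have h55 : ∑ i, (((A i).card * (B i).card * (C i).card : ℕ) : ℝ) ^ (omega ℂ / 3) ≤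
      (d : ℝ) ^ (omega ℂ - 2) * Fintype.card H := by
    refine (CohnKleinbergSzegedyUmans2005_thm55_general_maxCharDegree hS).trans ?_
    refine mul_le_mul_of_nonneg_right ?_ (Nat.cast_nonneg _)
    exact Real.rpow_le_rpow (Nat.cast_nonneg _) (by exact_mod_cast hdmax)
      (sub_nonneg.2 (omega_two_le (K := ℂ)))
  have hb' : (0 : ℝ) < (b : ℝ) := by exact_mod_cast hb
  have hD' : (0 : ℝ) < (D : ℝ) := by exact_mod_cast hD
  have hdpos : (0 : ℝ) < (d : ℝ) := by exact_mod_cast hd1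
  have h3b : (0 : ℝ) < 3 * (b : ℝ) := by positivity
  have hwω : w < omega ℂ := hlt
  have hw2 : (2 : ℝ) ≤ w := by
    rw [hw, le_div_iff₀ hb']; exact_mod_cast hab
  -- per triple: `q i / D ≤ V^{w/3} ≤ d^{w-ω} V^{ω/3}`
  have hterm : ∀ i, ((q i : ℕ) : ℝ) / (D : ℝ) ≤ (d : ℝ) ^ (w - omega ℂ) *
      ((((A i).card * (B i).card * (C i).card : ℕ)) : ℝ) ^ (omega ℂ / 3) := by
    intro i
    set V : ℕ := (A i).card * (B i).card * (C i).card with hV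
    have hq0 : (0 : ℝ) ≤ ((q i : ℕ) : ℝ) / (D : ℝ) := by positivity
    have hVpos : (0 : ℝ) < (V : ℝ) := by
      have : d ^ 3 ≤ V := hbig i
      have hd3 : 0 < d ^ 3 := pow_pos hd1 3
      exact_mod_cast lt_of_lt_of_le hd3 this
    -- real form of the integer certificate, `(3b)`-th roots
    have hr : (((q i : ℕ) : ℝ) / (D : ℝ)) ^ (3 * b) ≤ (V : ℝ) ^ a := by
      rw [div_pow, div_le_iff₀ (pow_pos hD' _)]
      have : ((q i ^ (3 * b) : ℕ) : ℝ) ≤ ((D ^ (3 * b) * V ^ a : ℕ) : ℝ) := by exact_mod_cast hq i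
      push_cast at this
      linarith
    have step1 : ((q i : ℕ) : ℝ) / (D : ℝ) ≤ (V : ℝ) ^ (w / 3) := by
      have hn : (3 * b : ℕ) ≠ 0 := by omega
      have e1 : ((((q i : ℕ) : ℝ) / (D : ℝ)) ^ (3 * b)) ^ ((3 * b : ℕ) : ℝ)⁻¹ =
          ((q i : ℕ) : ℝ) / (D : ℝ) := Real.pow_rpow_inv_natCast hq0 hn
      have e2 : ((V : ℝ) ^ a) ^ ((3 * b : ℕ) : ℝ)⁻¹ = (V : ℝ) ^ (w / 3) := by
        rw [← Real.rpow_natCast, ← Real.rpow_mul hVpos.le]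
        congr 1
        rw [hw]; push_cast; field_simp
      rw [← e1, ← e2]
      exact Real.rpow_le_rpow (pow_nonneg hq0 _) hr (by positivity)
    -- `V^{w/3} ≤ d^{w-ω} V^{ω/3}` since `V ≥ d³`: `V^{(ω-w)/3} ≥ (d³)^{(ω-w)/3} = d^{ω-w}`
    have step2 : (V : ℝ) ^ (w / 3) ≤ (d : ℝ) ^ (w - omega ℂ) * (V : ℝ) ^ (omega ℂ / 3) := by
      have hd3 : (d : ℝ) ^ (3 : ℝ) ≤ (V : ℝ) := by
        rw [show (3 : ℝ) = ((3 : ℕ) : ℝ) by norm_num, Real.rpow_natCast]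
        exact_mod_cast hbig i
      have hexp : 0 ≤ (omega ℂ - w) / 3 := by linarith
      have hmono : ((d : ℝ) ^ (3 : ℝ)) ^ ((omega ℂ - w) / 3) ≤ (V : ℝ) ^ ((omega ℂ - w) / 3) :=
        Real.rpow_le_rpow (by positivity) hd3 hexp
      rw [← Real.rpow_mul hdpos.le, show (3 : ℝ) * ((omega ℂ - w) / 3) = omega ℂ - w by ring] at hmono
      -- `V^{w/3} · d^{ω-w} ≤ V^{w/3} · V^{(ω-w)/3} = V^{ω/3}`
      have hsplit : (V : ℝ) ^ (omega ℂ / 3) = (V : ℝ) ^ (w / 3) * (V : ℝ) ^ ((omega ℂ - w) / 3) := by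
        rw [← Real.rpow_add hVpos]; ring_nf
      have hdd : (d : ℝ) ^ (w - omega ℂ) * (d : ℝ) ^ (omega ℂ - w) = 1 := by
        rw [← Real.rpow_add hdpos, show w - omega ℂ + (omega ℂ - w) = 0 by ring, Real.rpow_zero]
      calc (V : ℝ) ^ (w / 3) = 1 * (V : ℝ) ^ (w / 3) := (one_mul _).symm
        _ = ((d : ℝ) ^ (w - omega ℂ) * (d : ℝ) ^ (omega ℂ - w)) * (V : ℝ) ^ (w / 3) := by rw [hdd]
        _ = (d : ℝ) ^ (w - omega ℂ) * ((V : ℝ) ^ (w / 3) * (d : ℝ) ^ (omega ℂ - w)) := by ring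
        _ ≤ (d : ℝ) ^ (w - omega ℂ) * ((V : ℝ) ^ (w / 3) * (V : ℝ) ^ ((omega ℂ - w) / 3)) := by
            gcongr
        _ = (d : ℝ) ^ (w - omega ℂ) * (V : ℝ) ^ (omega ℂ / 3) := by rw [← hsplit]
    exact step1.trans step2
  -- sum: `Σ q / D ≤ d^{w-ω} Σ V^{ω/3} ≤ d^{w-ω} d^{ω-2} |H| = d^{w-2} |H|`
  have hle : (∑ i, ((q i : ℕ) : ℝ)) / (D : ℝ) ≤ (d : ℝ) ^ (w - 2) * Fintype.card H := by
    rw [Finset.sum_div]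
    refine (Finset.sum_le_sum fun i _ => hterm i).trans ?_
    rw [← Finset.mul_sum]
    refine (mul_le_mul_of_nonneg_left h55 (by positivity)).trans ?_
    rw [← mul_assoc, ← Real.rpow_add hdpos, show w - omega ℂ + (omega ℂ - 2) = w - 2 by ring]
  rw [div_le_iff₀ hD'] at hle
  -- `d^{w-2}` to the power `b` is the natural power `d^{a-2b}`
  have hpowb : ((d : ℝ) ^ (w - 2)) ^ b = ((d ^ (a - 2 * b) : ℕ) : ℝ) := by
    rw [← Real.rpow_natCast, ← Real.rpow_mul hdpos.le, Nat.cast_pow, ← Real.rpow_natCast]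
    congr 1
    rw [hw, Nat.cast_sub hab]; push_cast; field_simp
  have hfinal : (∑ i, ((q i : ℕ) : ℝ)) ^ b ≤ ((D ^ b * d ^ (a - 2 * b) * Fintype.card H ^ b : ℕ) : ℝ) := by
    have h0 : (0 : ℝ) ≤ ∑ i, ((q i : ℕ) : ℝ) := by positivity
    calc (∑ i, ((q i : ℕ) : ℝ)) ^ b ≤ ((d : ℝ) ^ (w - 2) * Fintype.card H * D) ^ b :=
          pow_le_pow_left₀ h0 hle b
      _ = ((D ^ b * d ^ (a - 2 * b) * Fintype.card H ^ b : ℕ) : ℝ) := by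
          rw [mul_pow, mul_pow, hpowb]; push_cast; ring
  have hsum' : ((D ^ b * d ^ (a - 2 * b) * Fintype.card H ^ b : ℕ) : ℝ) < ((∑ i, q i : ℕ) : ℝ) ^ b := by
    exact_mod_cast hsum
  push_cast at hsum' hfinal
  linarith

/-- **Certificate → theorem, host with an abelian subgroup `N` of index `t`** (dihedral / dicyclic /
generalized dihedral: `t = 2`): as `omega_le_div_of_simultaneousTPP_maxCharDegree` with `d = [H:N]`, since every
character degree of `H` is `≤ [H:N]` (CKSU 2005 §1.2; tree `maxCharDegree_le_index`).
[cite: CohnKleinbergSzegedyUmans2005, Thm. 5.5, Cor. 1.9, §1.2 and Def. 5.1] -/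
theorem omega_le_div_of_simultaneousTPP_abelianSubgroup {H : Type} [Group H] [Fintype H] [DecidableEq H]
    {N : ℕ} {A B C : Fin N → Finset H} (hS : SimultaneousTPP A B C) (K : Subgroup H) [IsMulCommutative K]
    {a b D : ℕ} (hab : 2 * b ≤ a) (hb : 0 < b) (hD : 0 < D) (q : Fin N → ℕ)
    (hq : ∀ i, q i ^ (3 * b) ≤ D ^ (3 * b) * ((A i).card * (B i).card * (C i).card) ^ a)
    (hbig : ∀ i, K.index ^ 3 ≤ (A i).card * (B i).card * (C i).card)
    (hsum : D ^ b * K.index ^ (a - 2 * b) * Fintype.card H ^ b < (∑ i, q i) ^ b) :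
    omega ℂ ≤ (a : ℝ) / (b : ℝ) := by
  haveI : K.FiniteIndex := Subgroup.finiteIndex_of_finite
  exact omega_le_div_of_simultaneousTPP_maxCharDegree hS (Nat.one_le_iff_ne_zero.mpr Subgroup.FiniteIndex.index_ne_zero)
    (maxCharDegree_le_index K) hab hb hD q hq hbig hsum

end Summit.MatrixMultiplication.OmegaCensus

end
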